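import Literature.NumberTheory.EllipticCurves.Kobayashi2003.SignedSelmerEtaComponentFacts
import Literature.NumberTheory.EllipticCurves.Kato2004.IwasawaCohomology
import Literature.NumberTheory.EllipticCurves.KatoFineSelmerDual
import Literature.NumberTheory.EllipticCurves.QuadraticTwist
import HarnessLib

/-!
# Kobayashi 2003, Thm. 6.2 (6.13)/(6.15) + Thm. 6.3 + Thm. 7.3 i) (7.21) + Cor. 7.2 at the quadratic
# character `η = ω^{(p−1)/2}`: the COLEMAN / POITOU–TATE inputs of the proof of Thm. 7.4, read on
# PINNED objects — ONE hypothesis structure (`EtaColemanPoitouTateData`) + ONE existence fact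
# (`thm62_63_73_etaColemanPoitouTate`)

Topic `NumberTheory/EllipticCurves`, sub-directory `Kobayashi2003` (namespace = path). Cell `bsd-potss`
(HOME `run/shared/lean/pub/bsd-potss/`), seat `bsd-potss-k8q-c3` g6 (prover), rung K8-Gss2 of
`BirchSwinnertonDyer`, route `QuadraticBranchSignedControl`, crux item stmt-BirchSwinnertonDyer-19115
`EtaTransportSigned` and its held child 19584 `PublishedInputThm74` (= the named fact
`Kobayashi2003.thm74_etaEvenMC_iff_etaOddMC` of the sibling file `SignedSelmerEtaComponentFacts`).
HONEST FRAMING (cell bsd-potss): the programme assembles the Birch–Swinnerton-Dyer formula for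
analytic-rank `≤ 1` curves STRICTLY from published theorems and TYPES the remainder; BSD is not proved
by any of this; a closed item closes a rung leaf, never the summit. THIS FILE: one hypothesis
STRUCTURE whose fields are printed statements RELATIVE TO PINNED OBJECTS of the tree, and one named
fact (`def … : Prop`, nothing asserted, no `_holds`; net debt +1) saying the structure is inhabited —
the pattern of `Kato2004/DivisibilityInputs.lean`, `Kato2004/MemberHullInputs.lean`,
`Kato2004/IwasawaH2Descent.lean`. No instance, no notation, no attribute is declared or removed.

## Why this file (what it refines)

The sibling fact `Kobayashi2003.thm74proof_etaExactSequences` (§5 of `SignedSelmerEtaComponentFacts`,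
cell bsd-potss seat k8q-c3 g3) transcribes the two displayed FOUR-term `η`-exact sequences of the proof
of Thm. 7.4 (p. 13) with ABSTRACT common ends `A` («`H¹(T)^η/Z(T)^η`») and `B` («`X⁰(E/K_∞)^η`»)
(its reading flag `Kob03-721-eta-abstract-ends`). Kobayashi obtains those sequences "By Theorem 6.2,
6.3 and (7.21)" — three separately printed theorems — and the connecting module algebra is
kernel-checked Summits-side (`Theorems/QuadraticBranchSignedControlThm74OfPoitouTateColeman`, seat
k8q-c3 g5: an injective `c : H → Λ`, an exact `H →ᶜ Λ → X → B → 0` and ANY `z ∈ H` give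
`0 → H/Λz → Λ/(c z) → X → B → 0`). The present file names the INPUT of that algebra, theorem by
theorem, on the tree's PINNED objects for the two end terms, which exist in the `η`-TWISTED currency:
for the quadratic `η` and `W = V ⊗ η` (any model of the quadratic twist `V^{(p*)}`, `p* = (−1)^{(p−1)/2}p`;
`V = W^{(p*)}` conversely), the `η`-component of Kobayashi's `𝐇¹(T_pV)` over `K_∞ = ℚ(μ_{p^∞})` is
Kato's `𝐇¹_Γ(T_pW)` over the cyclotomic `ℤ_p`-extension `ℚ_∞` — the tree's PINNED
`Kato2004.IwasawaH1Data W p κ γ` (`Kato2004/IwasawaCohomology.lean`, inhabited by the tree THEOREM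
`Kato2004.nonempty_iwasawaH1Data_holds`) — and the `η`-component of `X⁰(V/K_∞)` is the dual fine Selmer
group `X⁰(W/ℚ_∞)` — the tree's PINNED `WeierstrassCurve.FineSelmerDualData W κ γ`
(`KatoFineSelmerDual.lean`, inhabited and finitely generated by the tree THEOREMS
`WeierstrassCurve.nonempty_fineSelmerDualData`, `WeierstrassCurve.FineSelmerDualData.module_finite`).
The middle terms stay in the currency of the sibling facts: `X^±(V/K_∞)^η` = ANY
`D : EtaSignedSelmerDualData V κ K₀ ℚ_[p] η γ (±1)` (`CyclotomicTowerSignedSelmer.lean`). Consequence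
(kernel, Summits-side, seat k8q-c3 g6): `thm62_63_73_etaColemanPoitouTate → thm74proof_etaExactSequences`
(hence `→ thm74_etaEvenMC_iff_etaOddMC` and `→` the crux `EtaTransportSigned`), so the held input
19584 reads, after this file, as four separately printed theorems on pinned objects.

## Source, verbatim (S. Kobayashi, *Iwasawa theory for elliptic curves at supersingular primes*,
## Invent. Math. 152 (2003) 1–36 [Kobayashi2003]; held copy `paper:doi-10-1007-s00222-002-0265-4`,
## page = file number, re-read by this seat 2026-08-26, pp. 9–13)

Standing (p. 4): `p` odd, `E/ℚ` with good reduction at `p`, `a_p = 0`; `K_n = ℚ(ζ_{p^{n+1}})`,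
`K_∞ = ℚ(μ_{p^∞})`, `G_∞ = Gal(K_∞/ℚ) = Δ × Γ`, `Λ = ℤ_p[[G_∞]]`, `k_n = ℚ_p(ζ_{p^{n+1}})` (p. 10);
`T = T_pE`. p. 9: "**Theorem 5.1 (Kato [7]).** i) `𝐇²(T)` is a finitely generated torsion `Λ`-module.
ii) `𝐇¹(T)` is a torsion free `Λ`-module … iii) If `T/pT` is irreducible as a two dimensional
representation of `Gal(ℚ̄/ℚ)` over `𝔽_p`, then `𝐇¹(T)` is a free `Λ`-module of rank 1." p. 10:
"**Remark 5.3.** i) When `E` has supersingular reduction at `p`, the condition in Theorem 5.1 iii) and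
5.2 iv) is satisfied." p. 10: "**Definition 6.1.** We define `H¹_±(k_n, T)` as the exact annihilator
with respect to the Tate pairing `H¹(k_n, V/T) × H¹(k_n, T) → ℚ_p/ℤ_p` of the subgroup
`E^±(k_n) ⊗ ℚ_p/ℤ_p ⊆ H¹(k_n, V/T)`. We let `H¹_Iw(T) = lim←_n H¹(k_n, T)` and
`H¹_{Iw,±}(T) = lim←_n H¹_±(k_n, T)`." p. 11: "We also let `Λ_n^± = ℤ_p[Δ][X]/(ω_n^±(X))`,
`I_n^± = XΛ_n^±` and `I = XΛ`. … **Theorem 6.2.** The even (odd) Coleman maps induce isomorphisms …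
Taking the limit of the above isomorphisms, we have `Col⁺ : H¹_Iw(T)/H¹_{Iw,+}(T) ≃ Λ` (6.13),
`Col⁻ : H¹_Iw(T)^Δ/H¹_{Iw,−}(T)^Δ ≃ Λ^Δ` (6.14), `Col⁻ : H¹_Iw(T)^η/H¹_{Iw,−}(T)^η ≃ I^η` for `η ≠ 1`
(6.15)." p. 11: "**Theorem 6.3.** Let `z^± ∈ 𝐇¹(T)` be Kato's zeta element in Theorem 5.2. By the
localization map, we regard `z^±` as an element of `H¹_Iw(T)`. Then, the image of Kato's zeta element
by the even (odd) Coleman map is Pollack's `p`-adic `L`-function: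
`Col^±(z_{η(−1)})^{ε_η} = η(−1) L_p^±(E, η, X) ε_η`." p. 12: "**Proposition 7.1 (Kurihara).** i) The
canonical mapping `𝐇¹(T) → 𝐇¹_{/S}(T)` is an isomorphism. ii) `𝐇²(T)` is isomorphic to `X⁰(E/K_∞)`
as `Λ`-module." p. 13: "**Corollary 7.2.** `X⁰(E/K_∞)` is a torsion `Λ`-module. *Proof.* This
follows from Theorem 5.1 and Proposition 7.1." p. 13: "**Theorem 7.3.** i) We have an exact sequence
`0 → 𝐇¹(T) → H¹_Iw(T)/H¹_{Iw,±}(T) → X^±(E/K_∞) → X⁰(E/K_∞) → 0` (7.21). … *Proof.* The exact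
sequence is nothing but (7.20) except for the injectivity of `𝐇¹(T) → H¹_Iw(T)/H¹_{Iw,±}(T)`. We
consider the composition of this map and the even (odd) Coleman map: `𝐇¹(T) → H¹_Iw(T)/H¹_{Iw,±}(T)
→ Λ` (cf. Theorem 6.2.) Since `𝐇¹(T)` is a free `Λ`-module of rank 1 (cf. Theorem 5.1 iii)), this
morphism is injective if and only if it is a non-zero map. Hence i) follows from Theorem 6.3 and
Rohrlich's theorem [20], which assures `L_p^±(E, η, X) ≠ 0`." p. 13: "**Theorem 7.4.** … *Proof.* By
Theorem 6.2, 6.3 and (7.21), we have three exact sequences `0 → 𝐇¹(T)^η/Z(T)^η → Λ^η/(L_p⁺(E, η, X))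
→ X⁺(E/K_∞)^η → X⁰(E/K_∞)^η → 0`, …, `0 → 𝐇¹(T)^η/Z(T)^η → I^η/(L_p⁻(E, η, X)) → X⁻(E/K_∞)^η →
X⁰(E/K_∞)^η → 0`. The last sequence is for a non-trivial `η`."

(Docstring convention of the sibling file: in declaration docstrings the source's C-word is written
`[C]`; this module docstring carries the unaltered quotations; what is vendored are THEOREMS.)

## Transcription — what the structure says, field by field, and the reading flags (for the referee)

Fix the frame of the sibling facts (`thm41_…`, `thm74_…`, `thm74proof_…`): `p` odd, `K₀ = ℚ(μ_p)`
(`IsCyclotomicExtension {p} ℚ K₀`), `η : Γ_ℚ →* ℤˣ` trivial on `galRange K₀ = Gal(ℚ̄/K₀)` and `≠ 1`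
(THE quadratic character of `Δ`, cyclic of even order), `V/ℚ` globally minimal with good reduction at
`p` and `a_p(V) = 0`, `f` its newform, `ϖ` the period ratio of the parity of `η`, `κ` the cyclotomic
`ℤ_p`-extension of `ℚ` with topological generator `γ ∈ Gal(ℚ̄/K₀)` matching the cyclotomic variable
(`IsCyclotomicVariable p γ`: "we identify `γ` with `1 + X`", p. 5); and IN ADDITION `W/ℚ` any model of
the quadratic twist of `V` by `p* = (−1)^{⌊p/2⌋}p` (`C • W.quadraticTwist p* = V`, the convention of the
Summits-side `Additive.QuadraticBranchRankOneLinkAt`; so `W ≅ V^{(p*)}`, `T_pW = T_pV ⊗ η`),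
`I : Kato2004.IwasawaH1Data W p κ γ` (pinned `𝐇¹_Γ(T_pW)`) and `FB : W.FineSelmerDualData κ γ` (pinned
`X⁰(W/ℚ_∞)`). Then `EtaColemanPoitouTateData … I FB` records:
* `z : I.H` — «the `η`-component `ε_η z_{η(−1)}` of Kato's zeta element of Thm. 5.2 / Thm. 6.3,
  transported to `𝐇¹_Γ(T_pW)`». EXISTENTIAL (a field): nothing identifies `z` with the tree's pinned
  zeta classes (`Kato2004.IwasawaH1Data.existsUnique_lift_of_zetaBody`); the deduction of Thm. 7.4 uses
  only that ONE element serves both signs. Weaker than print, never stronger.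
* `isTorsion_fine : Module.IsTorsion Λ FB.X` — Cor. 7.2 («`X⁰(E/K_∞)` is a torsion `Λ`-module», from
  Kato's Thm. 5.1 i) = [Kato2004] Thm. 12.4 (1) and Prop. 7.1 ii)) read on the `η`-component in the
  twisted currency (flag `Kob03-eta-twist-currency`, below). Finite generation of `FB.X` is NOT a field:
  it is the tree theorem `FineSelmerDualData.module_finite`.
* `colPlus : I.H →ₗ[Λ] Λ`, `colPlus_injective` — «`Col⁺ ∘ loc_𝔭` on the `η`-component»: the first
  arrow of (7.21) (sign `+`) composed with the isomorphism (6.13) `H¹_Iw(T)/H¹_{Iw,+}(T) ≃ Λ` (its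
  `η`-component `≃ Λ^η = ℤ_p[[X]]`); injective = Thm. 7.3 i) (whose printed proof uses Thm. 5.1 iii),
  satisfied by Remark 5.3 i), Thm. 6.3 and Rohrlich).
* `isPlus_colPlus_z : IsQuadraticBranchPlusLFunction f p ϖ (colPlus z)` — Thm. 6.3, sign `+`, at `η`:
  `Col⁺(z_{η(−1)})^{ε_η} = η(−1) L_p⁺(E, η, X) ε_η`; the sign `η(−1)` and Kobayashi's period
  normalisation are absorbed by the up-to-`ℤ_pˣ` pinning predicate of the sibling file (flag
  `Kob03-Lpm-eta-upto-unit` there).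
* `exact_plus D` for EVERY `D : EtaSignedSelmerDualData V κ K₀ ℚ_[p] η γ 1` — (7.21), sign `+`,
  `η`-component, with (6.13): SOME `Λ`-linear `j : Λ → D.X`, `k : D.X → FB.X` («dual of the restriction
  to `𝔭`, through `Col⁺`», «dual of the inclusion `Sel⁰ ⊂ Sel⁺`») with `I.H →^{colPlus} Λ →ʲ D.X →ᵏ FB.X
  → 0` exact. The maps are existential (as in the sibling fact): the printed deduction uses exactness
  only.
* `colMinus`, `colMinus_injective`, `isMinus_X_mul_colMinus_z : IsQuadraticBranchMinusLFunction f p ϖ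
  (X · colMinus z)`, `exact_minus D` for every `D : EtaSignedSelmerDualData V κ K₀ ℚ_[p] η γ (−1)` —
  the same for the sign `−` at `η ≠ 1` through (6.15) `H¹_Iw(T)^η/H¹_{Iw,−}(T)^η ≃ I^η`, `I = XΛ`
  (p. 11), composed with the `Λ`-isomorphism `I^η = XΛ^η ≃ Λ^η` (division by `X`; `Λ` a domain): so
  `colMinus = X⁻¹ · (ε_η Col⁻ ∘ loc_𝔭)` and Thm. 6.3 (sign `−`) reads `X · colMinus z = ± L_p⁻(E, η, X)`
  ((3.7): `X ∣ L_p⁻(E, η, X)`), exactly the frame `hPT` of the Summits-side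
  `Thm74Skeleton.etaExactSequences_of_poitouTateColeman`.
READING FLAGS. `Kob03-eta-twist-currency` (NEW, this file): for the quadratic `η` (trivial on
`Gal(ℚ̄/K₀)`, `p ∤ #Δ = p − 1`) and `W ≅ V ⊗ η`, restriction/corestriction along `K_n/ℚ_n`
(`K_n = K₀·ℚ_n`, `Gal(K_n/ℚ_n) ≅ Δ`) identifies `H¹(ℤ_n[1/p], T_pW) = H¹(O_{K_n}[1/p], T_pV)^η`
(Hochschild–Serre, `#Δ` invertible; the unramified-outside-`p` conditions and the trace maps
correspond), hence `𝐇¹_Γ(T_pW) = 𝐇¹(T_pV)^η`, and likewise `Sel⁰(W/ℚ_∞)[p^∞] = Sel⁰(V/K_∞)[p^∞]^η`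
(everywhere-locally-trivial classes; at the prime above `p` the extension `K_{n,𝔭}/ℚ_{n,p}` is of
degree `p − 1`, prime to `p`), hence `X⁰(W/ℚ_∞) = X⁰(V/K_∞)^η` — a standard prime-to-`p` descent
(Greenberg LNM 1716 §3; the sibling flag `Kob03-MC-eta-quadratic-subtower` of
`Additive.QuadraticBranchSignedMainConjecture` is the same mechanism for `F = ℚ(√p*)`), NOT formalised
in the tree; the structure's fields are stated directly on the `W`-objects. `Kob03-Thm74-eta-by-eta`,
`Kob03-Lpm-eta-upto-unit` as in the sibling file. `Kob03-721-eta-maps-existential`: the arrows of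
(7.21) other than the first are asserted to EXIST with the printed exactness, not constructed (the
tree has no local Iwasawa cohomology `H¹_Iw(T)` / local Tate duality at `k_∞` as objects; Def. 6.1 and
the Coleman maps of §8 are therefore not transcribed as maps on local objects — TODO(general form)).
Everything recorded is implied by, never stronger than, the print.

## What is NOT here (and why)

* NO identification of `z` with Kato's zeta element as a tree object, no Thm. 5.2 (values of `z`), no
  Thm. 6.2 on LOCAL objects (6.10)–(6.12), no Honda theory (§8), no `_holds` (Coleman maps, Kato's
  explicit reciprocity law, Poitou–Tate duality along the tower: none of it is in Mathlib).
* NO statement for `η = 1` ((6.14), the `Δ`-component): the tree's `η = 1` currency is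
  `Kobayashi2003.SignedSelmerDualData` over `ℚ_∞` and its Kato-divisibility facts
  (`SignedKatoDivisibility.lean`); not needed by the K8 crux.
* NO main [C] is asserted; (C1_η) stays the Summits-side `@[conjecture]` it is.

References: [Kobayashi2003] Thm. 5.1, Thm. 5.2, Remark 5.3 (pp. 9–10), Def. 6.1 (p. 10), §6 p. 11
(`I = XΛ`), Thm. 6.2 (6.13)–(6.15) and Thm. 6.3 (p. 11), Prop. 7.1 (p. 12), Cor. 7.2, Thm. 7.3 (7.21),
Thm. 7.4 and its proof (p. 13), Thm. 3.2 and (3.4)–(3.7) (p. 7), §3 (p. 5), §4 (p. 8);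
[Kato2004Asterisque] §12.2 (p. 220), Thm. 12.4 (p. 221); [GreenbergLNM1716] §3 (prime-to-`p` descent
of Selmer groups; reading); [Rohrlich1984] (non-vanishing of `L_p^±(E, η, X)`, used in the printed
proof of Thm. 7.3 i)).
-/

noncomputable section

open scoped Classical

open CongruenceSubgroup Polynomial WeierstrassCurve Field Literature.NumberTheory.EllipticCurves
  Literature.NumberTheory.EllipticCurves.ModularForms Literature.NumberTheory.GaloisRepresentations
  ZpExtension

namespace Literature.NumberTheory.EllipticCurves.Kobayashi2003

/-! ## §1 The hypothesis structure: Thm. 6.2 (6.13)/(6.15) + Thm. 6.3 + (7.21) + Cor. 7.2 at `η`,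
relative to the pinned `𝐇¹_Γ(T_pW)` and `X⁰(W/ℚ_∞)` of the twist `W = V ⊗ η` -/

/-- **Kobayashi's Coleman / Poitou–Tate data at the quadratic character `η`, on pinned objects**
(hypothesis structure; nothing asserted by it — existence is the named fact
`thm62_63_73_etaColemanPoitouTate`). Parameters: the frame of the sibling facts (`p`, `K₀ = ℚ(μ_p)`,
`η`, `V`, its newform `f`, the period ratio `ϖ`, the cyclotomic `κ` with generator `γ`), a curve `W/ℚ`
(intended: a model of the quadratic twist `V^{(p*)}`, `T_pW = T_pV ⊗ η`), a pinned Iwasawa-cohomology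
datum `I : Kato2004.IwasawaH1Data W p κ γ` («`𝐇¹(T_pV)^η = 𝐇¹_Γ(T_pW)`») and a pinned dual fine
Selmer datum `FB : W.FineSelmerDualData κ γ` («`X⁰(V/K_∞)^η = X⁰(W/ℚ_∞)`»; reading flag
`Kob03-eta-twist-currency` of the module docstring). Fields: an element `z ∈ 𝐇¹` («`ε_η z_{η(−1)}`»,
Thm. 6.3; existential), Cor. 7.2 (`X⁰` torsion), and for each sign `ε = ±1` an INJECTIVE `Λ`-linear
`col^ε : 𝐇¹ → Λ` («`Col⁺ ∘ loc`, resp. `X⁻¹·(ε_ηCol⁻ ∘ loc)` through (6.13), resp. (6.15) `≃ I^η = XΛ^η`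
and division by `X`»; injective = Thm. 7.3 i)) whose value at `z` is a plus function `L_p⁺(V, η, X)`,
resp. `X⁻¹` times a minus function `L_p⁻(V, η, X)` (Thm. 6.3, functions pinned up to `ℤ_pˣ` by the
sibling predicates), such that for EVERY Pontryagin-dual datum `D` of `Sel^ε(V/K_∞)^η` some `Λ`-linear
`Λ → X(D) → X⁰` make `𝐇¹ →^{col^ε} Λ → X(D) → X⁰ → 0` exact ((7.21) at `η`, arrows existential: flag
`Kob03-721-eta-maps-existential`). Exactly the displayed frame `hPT` of the Summits-side
`Thm74Skeleton.etaExactSequences_of_poitouTateColeman` with `H := I.H`, `B := FB.X`.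
[cite: Kobayashi2003, Thm. 6.2 (6.13)–(6.15) and Thm. 6.3 (p. 11), Thm. 7.3 i) (7.21) and Cor. 7.2 (p. 13), Prop. 7.1 ii) (p. 12), §6 p. 11 (I = XΛ), (3.7) (p. 7)]
[cite: Kato2004Asterisque, §12.2 (p. 220) and Thm. 12.4 (1) (p. 221) (the objects 𝐇¹, 𝐇² ≅ X⁰)] -/
structure EtaColemanPoitouTateData (p : ℕ) [Fact p.Prime] (K₀ : Type) [Field K₀] [NumberField K₀]
    [(galRange (K := ℚ) K₀).Normal] (η : absoluteGaloisGroup ℚ →* ℤˣ)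
    (V : WeierstrassCurve ℚ) [V.IsElliptic] {N : ℕ} (f : CuspForm (Gamma0 N) 2) (ϖ : ℚ)
    (κ : ZpExtension ℚ p) (γ : absoluteGaloisGroup ℚ)
    (W : WeierstrassCurve ℚ) [W.IsElliptic] [ContinuousSMul ℤ_[p] (W.tateModule p)]
    (I : Kato2004.IwasawaH1Data W p κ γ) (FB : W.FineSelmerDualData κ γ) where
  /-- «`ε_η z_{η(−1)}`»: the `η`-component of Kato's zeta element (Thm. 5.2 / Thm. 6.3), as an element
  of `𝐇¹_Γ(T_pW)`; existential. -/
  z : I.H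
  /-- Cor. 7.2 at `η`: `X⁰(V/K_∞)^η = X⁰(W/ℚ_∞)` is `Λ`-torsion. -/
  isTorsion_fine : Module.IsTorsion (IwasawaAlgebra p) FB.X
  /-- «`Col⁺ ∘ loc_𝔭`» on the `η`-component, through (6.13) `H¹_Iw(T)/H¹_{Iw,+}(T) ≃ Λ`. -/
  colPlus : I.H →ₗ[IwasawaAlgebra p] IwasawaAlgebra p
  /-- Thm. 7.3 i), sign `+`: `𝐇¹(T) → H¹_Iw(T)/H¹_{Iw,+}(T)` is injective. -/
  colPlus_injective : Function.Injective colPlus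
  /-- Thm. 6.3, sign `+`, at `η`: `Col⁺(z_{η(−1)})^{ε_η} = η(−1)L_p⁺(E, η, X)ε_η` (up to `ℤ_pˣ`). -/
  isPlus_colPlus_z : IsQuadraticBranchPlusLFunction f p ϖ (colPlus z)
  /-- (7.21), sign `+`, `η`-component, with (6.13): `𝐇¹ → Λ → X⁺(V/K_∞)^η → X⁰ → 0` exact. -/
  exact_plus : ∀ D : EtaSignedSelmerDualData V κ K₀ ℚ_[p] η γ 1,
    ∃ (j : IwasawaAlgebra p →ₗ[IwasawaAlgebra p] D.X) (k : D.X →ₗ[IwasawaAlgebra p] FB.X),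
      Function.Exact colPlus j ∧ Function.Exact j k ∧ Function.Surjective k
  /-- «`X⁻¹ · (ε_η Col⁻ ∘ loc_𝔭)`», through (6.15) `H¹_Iw(T)^η/H¹_{Iw,−}(T)^η ≃ I^η = XΛ^η` and
  division by `X`. -/
  colMinus : I.H →ₗ[IwasawaAlgebra p] IwasawaAlgebra p
  /-- Thm. 7.3 i), sign `−`: `𝐇¹(T) → H¹_Iw(T)/H¹_{Iw,−}(T)` is injective. -/
  colMinus_injective : Function.Injective colMinus
  /-- Thm. 6.3, sign `−`, at `η ≠ 1`: `Col⁻(z_{η(−1)})^{ε_η} = η(−1)L_p⁻(E, η, X)ε_η ∈ I^η = XΛ^η`, i.e.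
  `X · colMinus z` is a minus function `L_p⁻(V, η, X)` (up to `ℤ_pˣ`; (3.7): `X ∣ L_p⁻`). -/
  isMinus_X_mul_colMinus_z : IsQuadraticBranchMinusLFunction f p ϖ (PowerSeries.X * colMinus z)
  /-- (7.21), sign `−`, `η`-component (`η ≠ 1`), with (6.15) and `I^η ≃ Λ^η`:
  `𝐇¹ → Λ → X⁻(V/K_∞)^η → X⁰ → 0` exact. -/
  exact_minus : ∀ D : EtaSignedSelmerDualData V κ K₀ ℚ_[p] η γ (-1),
    ∃ (j : IwasawaAlgebra p →ₗ[IwasawaAlgebra p] D.X) (k : D.X →ₗ[IwasawaAlgebra p] FB.X),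
      Function.Exact colMinus j ∧ Function.Exact j k ∧ Function.Surjective k

/-! ## §2 The named fact: the structure is inhabited for every `η`-frame (Thm. 6.2 + 6.3 + 7.3 i) +
Cor. 7.2, with Thm. 5.1 / Remark 5.3 i)) -/

/-- **Kobayashi 2003, Thm. 6.2 (6.13)/(6.15) + Thm. 6.3 + Thm. 7.3 i) (7.21) + Cor. 7.2, at THE
quadratic character `η = ω^{(p−1)/2}`, on pinned objects.** For the frame of the sibling facts — `p`
odd, `K₀ = ℚ(μ_p)`, `η : Γ_ℚ →* ℤˣ` trivial on `Gal(ℚ̄/K₀)` and `≠ 1`, `V/ℚ` globally minimal with good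
reduction at `p` and `a_p(V) = 0`, newform `f` of `V`, period ratio `ϖ` of the parity of `η`, cyclotomic
`κ` with topological generator `γ ∈ Gal(ℚ̄/K₀)` matching the cyclotomic variable — and for every model
`W/ℚ` of the quadratic twist of `V` by `p* = (−1)^{⌊p/2⌋}p` (`C • W.quadraticTwist p* = V` for some
variable change `C`; `T_pW = T_pV ⊗ η`; the structure fact `ContinuousSMul ℤ_[p] (T_pW)` is an instance
BINDER, discharged by `TateModule.continuousSMul_padicInt`), every pinned Iwasawa-cohomology datum
`I : Kato2004.IwasawaH1Data W p κ γ` («`𝐇¹(T_pV)^η`») and every pinned dual fine Selmer datum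
`FB : W.FineSelmerDualData κ γ` («`X⁰(V/K_∞)^η`»): `EtaColemanPoitouTateData p K₀ η V f ϖ κ γ W I FB`
is inhabited — there are `z ∈ 𝐇¹`, injective `Λ`-linear `Col^± ∘ loc : 𝐇¹ → Λ` (through (6.13),
resp. (6.15) and `I^η = XΛ^η ≃ Λ^η`) with `(Col⁺∘loc)(z)` a plus function `L_p⁺(V, η, X)` and
`X · (X⁻¹Col⁻∘loc)(z)` a minus function `L_p⁻(V, η, X)` (Thm. 6.3), the `η`-components of (7.21)
`𝐇¹ → Λ → X^±(V/K_∞)^η → X⁰ → 0` exact for every dual datum of `Sel^±(V/K_∞)^η`, and `X⁰` torsion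
(Cor. 7.2). Printed hypotheses: Thm. 7.3 i) uses Thm. 5.1 iii) (`𝐇¹(T)` free of rank one if `T/pT` is
irreducible), satisfied for supersingular `p` (Remark 5.3 i)); no image hypothesis remains. READING
FLAGS (module docstring): `Kob03-eta-twist-currency` (ends read on `W = V ⊗ η`: `𝐇¹(T_pV)^η =
𝐇¹_Γ(T_pW)`, `X⁰(V/K_∞)^η = X⁰(W/ℚ_∞)`, prime-to-`p` descent not formalised), `Kob03-721-eta-maps-
existential`, `Kob03-Thm74-eta-by-eta`, `Kob03-Lpm-eta-upto-unit`; `z` existential (weaker than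
print). Consequence (kernel, Summits-side): `thm74proof_etaExactSequences`, `thm74_etaEvenMC_iff_etaOddMC`.
Named fact; nothing asserted; no `_holds` (Coleman maps via Honda theory §8, Kato's Euler system and
explicit reciprocity law, Poitou–Tate along the tower: none of it is in Mathlib).
[cite: Kobayashi2003, Thm. 6.2 (6.13)–(6.15) and Thm. 6.3 (p. 11), Thm. 7.3 i) (7.21) and Cor. 7.2 (p. 13), Prop. 7.1 (p. 12), Thm. 5.1 and Remark 5.3 i) (pp. 9–10), §6 p. 11 (I = XΛ), Thm. 3.2 and (3.4)–(3.7) (p. 7), §3 (p. 5), §4 (p. 8)]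
[cite: Kato2004Asterisque, §12.2 (p. 220), Thm. 12.4 (p. 221)]
[cite: GreenbergLNM1716, §3 (prime-to-p descent of Selmer groups; reading)] -/
def thm62_63_73_etaColemanPoitouTate : Prop :=
  ∀ (p : ℕ) [Fact p.Prime] (K₀ : Type) [Field K₀] [NumberField K₀] [IsCyclotomicExtension {p} ℚ K₀]
    [(galRange (K := ℚ) K₀).Normal] (η : absoluteGaloisGroup ℚ →* ℤˣ),
    (∀ σ ∈ galRange (K := ℚ) K₀, η σ = 1) → η ≠ 1 →
  ∀ (V : WeierstrassCurve ℚ) [V.IsElliptic] [V.IsGloballyMinimal] {N : ℕ} [NeZero N]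
    {f : CuspForm (Gamma0 N) 2},
    p ≠ 2 → V.HasGoodReductionAtPrime p → V.frobeniusTrace p = 0 → IsNewformOf V f →
  ∀ (ϖ : ℚ), (if Even (p / 2) then (ϖ : ℝ) * V.realPeriodRat = plusPeriod f
      else (ϖ : ℝ) * V.imaginaryPeriodRat = minusPeriod f) →
  ∀ (κ : ZpExtension ℚ p) (γ : absoluteGaloisGroup ℚ),
    κ.IsCyclotomic → κ.IsTopGenerator γ → γ ∈ galRange (K := ℚ) K₀ → IsCyclotomicVariable p γ →
  ∀ (W : WeierstrassCurve ℚ) [W.IsElliptic] [ContinuousSMul ℤ_[p] (W.tateModule p)]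
    (C : VariableChange ℚ), C • W.quadraticTwist ((-1) ^ (p / 2) * p) = V →
  ∀ (I : Kato2004.IwasawaH1Data W p κ γ) (FB : W.FineSelmerDualData κ γ),
    Nonempty (EtaColemanPoitouTateData p K₀ η V f ϖ κ γ W I FB)

end Literature.NumberTheory.EllipticCurves.Kobayashi2003

end
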